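import Summits.BirchSwinnertonDyer.BirchSwinnertonDyer.Theorems.ManinLocalTwoThreeEulerProductTables
import Summits.BirchSwinnertonDyer.BirchSwinnertonDyer.Theorems.ManinLocalTwoThreeQCoefficientBridge
import HarnessLib

/-!
# Level 44, part 3a: the Euler functions `E_δ = ∏ (1 − q^{δn})`, `δ ∣ 44`, through `q³³`, and the `η`-quotient bookkeeping

Cell `bsd-f2-manin`, route `ManinLocalTwoThree`, crux C2 `ManinOddAtFour` (stmt-BirchSwinnertonDyer-22967), LEAD p1 gen 24;
`--supports stmt-BirchSwinnertonDyer-22967` (helper).  Third file of the level-44 unit (`…CurveExclusionFortyFour`,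
`…NewformPinningFortyFourOfTable`): the `q`-EXPANSION INPUT of the coefficient table of `M₂(Γ₀(44))` that part 2 takes as hypotheses.

* §1 `etaQuotient_eq_qParam_pow_mul_prod` — `∏ η(δτ)^{r_δ} = q^a · ∏ E_δ(τ)^{r_δ}` when `Σ δ r_δ = 24a` (the integral
  `q`-shift case of the tree's `etaQuotient_eq_prod_eulerFn_zpow`, which is `a = 0`); `coeff_sum_range_C_mul_X_pow`.
* §2 the remainder estimates `E_δ = P_δ(q) + o(q³³)` for `δ = 1, 2, 4, 11, 22, 44` in the format of the tree's
  `QRemainder` calculus, with `P_δ` Euler's pentagonal polynomial in `q^δ` truncated at degree `33`; the coefficients come from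
  the kernel-computed table `EulerTables.coeff_formalEulerPow_eq_getD` / `EulerTables.eulerTruncList_one_forty` (so nothing here
  is taken on trust: `1 − q − q² + q⁵ + q⁷ − q¹² − q¹⁵ + q²² + q²⁶` IS `∏_{n ≤ 33}(1 − qⁿ) mod q³⁴`).

Pure `q`-series bookkeeping; nothing here is a statement about an elliptic curve.  Nothing here proves C2, Manin's conjecture or BSD.
[cite: Apostol1990, Thm. 14.3] [cite: Koehler2011, §1.1, §2.1]
-/

set_option autoImplicit false
-- lint-debt: the directory name repeats the summit name (sibling precedent `ManinLocalTwoThreeQRemainderCalculus.lean`)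
set_option linter.dupNamespace false

noncomputable section

open Complex Filter Topology Polynomial
open UpperHalfPlane hiding I
open scoped Real Topology Manifold MatrixGroups
open Literature.NumberTheory.EllipticCurves Literature.NumberTheory.EllipticCurves.ModularForms

namespace Summit.BirchSwinnertonDyer.BirchSwinnertonDyer.Theorems.ManinLocalTwoThree.LevelFortyFour

open QRemainder EulerTables

/-! ## §1 `η`-quotients with integral `q`-shift; coefficients of explicit polynomials -/

/-- **`∏_δ η(δτ)^{r_δ} = q^a · ∏_δ (∏_n (1 − q^{δn}))^{r_δ}` when `Σ δ r_δ = 24 a`.** [cite: Koehler2011, §2.1] -/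
theorem etaQuotient_eq_qParam_pow_mul_prod (N : ℕ) (r : ℕ → ℤ) (a : ℕ)
    (hS : ∑ δ ∈ N.divisors, (δ : ℤ) * r δ = 24 * a) (τ : ℍ) :
    etaQuotient N r τ = Function.Periodic.qParam 1 (τ : ℂ) ^ a * ∏ δ ∈ N.divisors, eulerFn δ τ ^ r δ := by
  rw [etaQuotient_apply]
  simp_rw [eta_natMul_eq_qParam_mul_eulerFn, mul_zpow, Finset.prod_mul_distrib]
  have hq : ∀ δ : ℕ, Function.Periodic.qParam 24 ((δ : ℂ) * τ) ^ (r δ) =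
      cexp (2 * π * Complex.I * τ / 24 * (((δ : ℤ) * r δ : ℤ) : ℂ)) := fun δ ↦ by
    rw [Function.Periodic.qParam, ← Complex.exp_int_mul]
    congr 1
    push_cast
    ring
  simp_rw [hq]
  rw [← Complex.exp_sum, ← Finset.mul_sum, ← Int.cast_sum, hS]
  congr 1
  rw [Function.Periodic.qParam, ← Complex.exp_nat_mul]
  congr 1
  push_cast
  ring

/-- The `n`-th coefficient of `Σ_{k < M} C(c_k) X^k` is `c_n` (`n < M`). [folklore] -/
theorem coeff_sum_range_C_mul_X_pow (c : ℕ → ℂ) {M n : ℕ} (hn : n < M) :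
    (∑ k ∈ Finset.range M, C (c k) * X ^ k).coeff n = c n := by
  rw [finsetSum_coeff]
  simp only [coeff_C_mul, coeff_X_pow]
  rw [Finset.sum_eq_single n (fun k _ hk ↦ by simp [Ne.symm hk]) (fun h ↦ absurd (Finset.mem_range.mpr hn) h)]
  simp

/-! ## §2 The six Euler functions at level `44` through `q³³` -/

/-- The pentagonal table, scaled: `coeff n (∏ (1 − X^{δm})) = [δ ∣ n] · coeff_{n/δ} ∏(1 − X^m)`, evaluated from the kernel
table for `n ≤ 33`. [cite: Apostol1990, Thm. 14.3] -/
theorem coeff_formalEulerScaled_eq_of_le {δ n : ℕ} (hn : n ≤ 33) :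
    PowerSeries.coeff n (formalEulerScaled δ) =
      if δ ∣ n then
        ([1, -1, -1, 0, 0, 1, 0, 1, 0, 0, 0, 0, -1, 0, 0, -1, 0, 0, 0, 0, 0, 0, 1, 0, 0, 0, 1, 0, 0, 0, 0, 0, 0, 0, 0,
          -1, 0, 0, 0, 0, -1] : List ℤ).getD (n / δ) 0
      else 0 := by
  rw [coeff_formalEulerScaled]
  split_ifs with h
  · rw [coeff_formalEulerPow_eq_getD (M := 40) ((Nat.div_le_self n δ).trans (hn.trans (by norm_num))),
      eulerTruncList_one_forty]
  · rfl


/-- **`∏ (1 − q^{1n}) = 1 - X - X ^ 2 + X ^ 5 + X ^ 7 - X ^ 12 - X ^ 15 + X ^ 22 + X ^ 26 + o(q³³)`** (`q = e^{2πiτ}`). [cite: Apostol1990, Thm. 14.3] -/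
theorem tendsto_eulerFn_one_thirtyThree :
    Tendsto (fun τ : ℍ ↦ (eulerFn 1 τ - (1 - X - X ^ 2 + X ^ 5 + X ^ 7 - X ^ 12 - X ^ 15 + X ^ 22 + X ^ 26 : ℂ[X]).eval (Function.Periodic.qParam 1 (τ : ℂ)))
      / Function.Periodic.qParam 1 (τ : ℂ) ^ 33) atImInfty (𝓝 0) := by
  refine congr_poly ?_ (tendsto_of_hasSum (periodic_eulerFn 1) (mdifferentiable_eulerFn 1)
    (isBoundedAtImInfty_eulerFn (by norm_num)) (hasSum_eulerFn (by norm_num)) 33)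
  have h : ∀ n : ℕ, n ≤ 33 → (PowerSeries.coeff n (formalEulerScaled 1) : ℤ) =
      ([1, -1, -1, 0, 0, 1, 0, 1, 0, 0, 0, 0, -1, 0, 0, -1, 0, 0, 0, 0, 0, 0, 1, 0, 0, 0, 1, 0, 0, 0, 0, 0, 0, 0] : List ℤ).getD n 0 := by
    intro n hn
    rw [coeff_formalEulerScaled_eq_of_le hn]
    interval_cases n <;> decide
  simp only [Finset.sum_range_succ, Finset.sum_range_zero, h 0 (by norm_num), h 1 (by norm_num), h 2 (by norm_num), h 3 (by norm_num), h 4 (by norm_num), h 5 (by norm_num), h 6 (by norm_num), h 7 (by norm_num), h 8 (by norm_num), h 9 (by norm_num), h 10 (by norm_num), h 11 (by norm_num), h 12 (by norm_num), h 13 (by norm_num), h 14 (by norm_num), h 15 (by norm_num), h 16 (by norm_num), h 17 (by norm_num), h 18 (by norm_num), h 19 (by norm_num), h 20 (by norm_num), h 21 (by norm_num), h 22 (by norm_num), h 23 (by norm_num), h 24 (by norm_num), h 25 (by norm_num), h 26 (by norm_num), h 27 (by norm_num), h 28 (by norm_num), h 29 (by norm_num), h 30 (by norm_num), h 31 (by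 norm_num), h 32 (by norm_num), h 33 (by norm_num)]
  norm_num
  ring

/-- **`∏ (1 − q^{2n}) = 1 - X ^ 2 - X ^ 4 + X ^ 10 + X ^ 14 - X ^ 24 - X ^ 30 + o(q³³)`** (`q = e^{2πiτ}`). [cite: Apostol1990, Thm. 14.3] -/
theorem tendsto_eulerFn_two_thirtyThree :
    Tendsto (fun τ : ℍ ↦ (eulerFn 2 τ - (1 - X ^ 2 - X ^ 4 + X ^ 10 + X ^ 14 - X ^ 24 - X ^ 30 : ℂ[X]).eval (Function.Periodic.qParam 1 (τ : ℂ)))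
      / Function.Periodic.qParam 1 (τ : ℂ) ^ 33) atImInfty (𝓝 0) := by
  refine congr_poly ?_ (tendsto_of_hasSum (periodic_eulerFn 2) (mdifferentiable_eulerFn 2)
    (isBoundedAtImInfty_eulerFn (by norm_num)) (hasSum_eulerFn (by norm_num)) 33)
  have h : ∀ n : ℕ, n ≤ 33 → (PowerSeries.coeff n (formalEulerScaled 2) : ℤ) =
      ([1, 0, -1, 0, -1, 0, 0, 0, 0, 0, 1, 0, 0, 0, 1, 0, 0, 0, 0, 0, 0, 0, 0, 0, -1, 0, 0, 0, 0, 0, -1, 0, 0, 0] : List ℤ).getD n 0 := by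
    intro n hn
    rw [coeff_formalEulerScaled_eq_of_le hn]
    interval_cases n <;> decide
  simp only [Finset.sum_range_succ, Finset.sum_range_zero, h 0 (by norm_num), h 1 (by norm_num), h 2 (by norm_num), h 3 (by norm_num), h 4 (by norm_num), h 5 (by norm_num), h 6 (by norm_num), h 7 (by norm_num), h 8 (by norm_num), h 9 (by norm_num), h 10 (by norm_num), h 11 (by norm_num), h 12 (by norm_num), h 13 (by norm_num), h 14 (by norm_num), h 15 (by norm_num), h 16 (by norm_num), h 17 (by norm_num), h 18 (by norm_num), h 19 (by norm_num), h 20 (by norm_num), h 21 (by norm_num), h 22 (by norm_num), h 23 (by norm_num), h 24 (by norm_num), h 25 (by norm_num), h 26 (by norm_num), h 27 (by norm_num), h 28 (by norm_num), h 29 (by norm_num), h 30 (by norm_num), h 31 (by norm_num), h 32 (by norm_num), h 33 (by norm_num)]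
  norm_num
  ring

/-- **`∏ (1 − q^{4n}) = 1 - X ^ 4 - X ^ 8 + X ^ 20 + X ^ 28 + o(q³³)`** (`q = e^{2πiτ}`). [cite: Apostol1990, Thm. 14.3] -/
theorem tendsto_eulerFn_four_thirtyThree :
    Tendsto (fun τ : ℍ ↦ (eulerFn 4 τ - (1 - X ^ 4 - X ^ 8 + X ^ 20 + X ^ 28 : ℂ[X]).eval (Function.Periodic.qParam 1 (τ : ℂ)))
      / Function.Periodic.qParam 1 (τ : ℂ) ^ 33) atImInfty (𝓝 0) := by
  refine congr_poly ?_ (tendsto_of_hasSum (periodic_eulerFn 4) (mdifferentiable_eulerFn 4)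
    (isBoundedAtImInfty_eulerFn (by norm_num)) (hasSum_eulerFn (by norm_num)) 33)
  have h : ∀ n : ℕ, n ≤ 33 → (PowerSeries.coeff n (formalEulerScaled 4) : ℤ) =
      ([1, 0, 0, 0, -1, 0, 0, 0, -1, 0, 0, 0, 0, 0, 0, 0, 0, 0, 0, 0, 1, 0, 0, 0, 0, 0, 0, 0, 1, 0, 0, 0, 0, 0] : List ℤ).getD n 0 := by
    intro n hn
    rw [coeff_formalEulerScaled_eq_of_le hn]
    interval_cases n <;> decide
  simp only [Finset.sum_range_succ, Finset.sum_range_zero, h 0 (by norm_num), h 1 (by norm_num), h 2 (by norm_num), h 3 (by norm_num), h 4 (by norm_num), h 5 (by norm_num), h 6 (by norm_num), h 7 (by norm_num), h 8 (by norm_num), h 9 (by norm_num), h 10 (by norm_num), h 11 (by norm_num), h 12 (by norm_num), h 13 (by norm_num), h 14 (by norm_num), h 15 (by norm_num), h 16 (by norm_num), h 17 (by norm_num), h 18 (by norm_num), h 19 (by norm_num), h 20 (by norm_num), h 21 (by norm_num), h 22 (by norm_num), h 23 (by norm_num), h 24 (by norm_num), h 25 (by norm_num), h 26 (by norm_num),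 h 27 (by norm_num), h 28 (by norm_num), h 29 (by norm_num), h 30 (by norm_num), h 31 (by norm_num), h 32 (by norm_num), h 33 (by norm_num)]
  norm_num
  ring

/-- **`∏ (1 − q^{11n}) = 1 - X ^ 11 - X ^ 22 + o(q³³)`** (`q = e^{2πiτ}`). [cite: Apostol1990, Thm. 14.3] -/
theorem tendsto_eulerFn_eleven_thirtyThree :
    Tendsto (fun τ : ℍ ↦ (eulerFn 11 τ - (1 - X ^ 11 - X ^ 22 : ℂ[X]).eval (Function.Periodic.qParam 1 (τ : ℂ)))
      / Function.Periodic.qParam 1 (τ : ℂ) ^ 33) atImInfty (𝓝 0) := by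
  refine congr_poly ?_ (tendsto_of_hasSum (periodic_eulerFn 11) (mdifferentiable_eulerFn 11)
    (isBoundedAtImInfty_eulerFn (by norm_num)) (hasSum_eulerFn (by norm_num)) 33)
  have h : ∀ n : ℕ, n ≤ 33 → (PowerSeries.coeff n (formalEulerScaled 11) : ℤ) =
      ([1, 0, 0, 0, 0, 0, 0, 0, 0, 0, 0, -1, 0, 0, 0, 0, 0, 0, 0, 0, 0, 0, -1, 0, 0, 0, 0, 0, 0, 0, 0, 0, 0, 0] : List ℤ).getD n 0 := by
    intro n hn
    rw [coeff_formalEulerScaled_eq_of_le hn]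
    interval_cases n <;> decide
  simp only [Finset.sum_range_succ, Finset.sum_range_zero, h 0 (by norm_num), h 1 (by norm_num), h 2 (by norm_num), h 3 (by norm_num), h 4 (by norm_num), h 5 (by norm_num), h 6 (by norm_num), h 7 (by norm_num), h 8 (by norm_num), h 9 (by norm_num), h 10 (by norm_num), h 11 (by norm_num), h 12 (by norm_num), h 13 (by norm_num), h 14 (by norm_num), h 15 (by norm_num), h 16 (by norm_num), h 17 (by norm_num), h 18 (by norm_num), h 19 (by norm_num), h 20 (by norm_num), h 21 (by norm_num), h 22 (by norm_num), h 23 (by norm_num), h 24 (by norm_num), h 25 (by norm_num), h 26 (by norm_num), h 27 (by norm_num), h 28 (by norm_num), h 29 (by norm_num), h 30 (by norm_num), h 31 (by norm_num), h 32 (by norm_num), h 33 (by norm_num)]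
  norm_num
  ring

/-- **`∏ (1 − q^{22n}) = 1 - X ^ 22 + o(q³³)`** (`q = e^{2πiτ}`). [cite: Apostol1990, Thm. 14.3] -/
theorem tendsto_eulerFn_twentyTwo_thirtyThree :
    Tendsto (fun τ : ℍ ↦ (eulerFn 22 τ - (1 - X ^ 22 : ℂ[X]).eval (Function.Periodic.qParam 1 (τ : ℂ)))
      / Function.Periodic.qParam 1 (τ : ℂ) ^ 33) atImInfty (𝓝 0) := by
  refine congr_poly ?_ (tendsto_of_hasSum (periodic_eulerFn 22) (mdifferentiable_eulerFn 22)
    (isBoundedAtImInfty_eulerFn (by norm_num)) (hasSum_eulerFn (by norm_num)) 33)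
  have h : ∀ n : ℕ, n ≤ 33 → (PowerSeries.coeff n (formalEulerScaled 22) : ℤ) =
      ([1, 0, 0, 0, 0, 0, 0, 0, 0, 0, 0, 0, 0, 0, 0, 0, 0, 0, 0, 0, 0, 0, -1, 0, 0, 0, 0, 0, 0, 0, 0, 0, 0, 0] : List ℤ).getD n 0 := by
    intro n hn
    rw [coeff_formalEulerScaled_eq_of_le hn]
    interval_cases n <;> decide
  simp only [Finset.sum_range_succ, Finset.sum_range_zero, h 0 (by norm_num), h 1 (by norm_num), h 2 (by norm_num), h 3 (by norm_num), h 4 (by norm_num), h 5 (by norm_num), h 6 (by norm_num), h 7 (by norm_num), h 8 (by norm_num), h 9 (by norm_num), h 10 (by norm_num), h 11 (by norm_num), h 12 (by norm_num), h 13 (by norm_num), h 14 (by norm_num), h 15 (by norm_num), h 16 (by norm_num), h 17 (by norm_num), h 18 (by norm_num), h 19 (by norm_num), h 20 (by norm_num), h 21 (by norm_num), h 22 (by norm_num), h 23 (by norm_num), h 24 (by norm_num), h 25 (by norm_num), h 26 (by norm_num), h 27 (by norm_num), h 28 (by norm_num), h 29 (by norm_num), h 30 (by norm_num), h 31 (by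 norm_num), h 32 (by norm_num), h 33 (by norm_num)]
  norm_num
  ring

/-- **`∏ (1 − q^{44n}) = 1 + o(q³³)`** (`q = e^{2πiτ}`). [cite: Apostol1990, Thm. 14.3] -/
theorem tendsto_eulerFn_fortyFour_thirtyThree :
    Tendsto (fun τ : ℍ ↦ (eulerFn 44 τ - (1 : ℂ[X]).eval (Function.Periodic.qParam 1 (τ : ℂ)))
      / Function.Periodic.qParam 1 (τ : ℂ) ^ 33) atImInfty (𝓝 0) := by
  refine congr_poly ?_ (tendsto_of_hasSum (periodic_eulerFn 44) (mdifferentiable_eulerFn 44)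
    (isBoundedAtImInfty_eulerFn (by norm_num)) (hasSum_eulerFn (by norm_num)) 33)
  have h : ∀ n : ℕ, n ≤ 33 → (PowerSeries.coeff n (formalEulerScaled 44) : ℤ) =
      ([1, 0, 0, 0, 0, 0, 0, 0, 0, 0, 0, 0, 0, 0, 0, 0, 0, 0, 0, 0, 0, 0, 0, 0, 0, 0, 0, 0, 0, 0, 0, 0, 0, 0] : List ℤ).getD n 0 := by
    intro n hn
    rw [coeff_formalEulerScaled_eq_of_le hn]
    interval_cases n <;> decide
  simp only [Finset.sum_range_succ, Finset.sum_range_zero, h 0 (by norm_num), h 1 (by norm_num), h 2 (by norm_num), h 3 (by norm_num), h 4 (by norm_num), h 5 (by norm_num), h 6 (by norm_num), h 7 (by norm_num), h 8 (by norm_num), h 9 (by norm_num), h 10 (by norm_num), h 11 (by norm_num), h 12 (by norm_num), h 13 (by norm_num), h 14 (by norm_num), h 15 (by norm_num), h 16 (by norm_num), h 17 (by norm_num), h 18 (by norm_num), h 19 (by norm_num), h 20 (by norm_num), h 21 (by norm_num), h 22 (by norm_num), h 23 (by norm_num), h 24 (by norm_num), h 25 (by norm_num), h 26 (by norm_num),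 h 27 (by norm_num), h 28 (by norm_num), h 29 (by norm_num), h 30 (by norm_num), h 31 (by norm_num), h 32 (by norm_num), h 33 (by norm_num)]
  norm_num


end Summit.BirchSwinnertonDyer.BirchSwinnertonDyer.Theorems.ManinLocalTwoThree.LevelFortyFour

end
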